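import Literature.NumberTheory.Sieve.DrappeauDispersionS1PhaseSum
import Literature.NumberTheory.Sieve.DrappeauDispersionS1Truncation
import HarnessLib

/-!
# Drappeau 2017, §5.5: the Taylor step `e(ha₁/(q₀q₁q₂a₂n₀n₁)) = 1 + O(·)` in `ℛ₁(q₀,n₀)`

Topic `Literature/NumberTheory/Sieve`, part of the formalisation of §5 of S. Drappeau, Proc. London
Math. Soc. (3) 114 (2017) 684–732 = arXiv:1504.05549 (Theorem 5.1 = the named fact
`Literature.NumberTheory.Sieve.Drappeau2017_theorem51`).  Everything here is PROVED; no definition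
and no named fact is introduced.

§5.5 (arXiv p. 20): "Taking the exponential, we may approximate
`e(ha₁/(q₀q₁q₂a₂n₀n₁)) = 1 + O(|ha₁|/(q₀q₁q₂|a₂|n₀n₁))`.  Inserting in `ℛ₁`, the error term
contributes a quantity `≪ (|a₁|q₀H)/(|a₂|n₀Q²N) · Q²/q₀² · N²/n₀ ≪ x^ε|a₁|NQ²M^{−1}` which is clearly
acceptable.  We therefore evaluate `ℛ₁' := ∑ … e(a₁h (n₁−n₂)/q₀ · \overline{q₁a₂n₀n₂}/(n₁q₂) −
a₁h\overline{q₀q₁q₂n₁}/(a₂n₀))`."  For the tree's piece with explicit phase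
(`Drappeau2017.R1piece_reindexed_eq_phase`):

* `Drappeau2017.norm_sum4_sub_le` — bookkeeping: two four-fold sums differing in the innermost
  factor differ by at most `∑ |c| ∑ |w||d||e| · (bound on the inner difference)`;
* `Drappeau2017.norm_hsum_phase_sub_le` — the inner difference: dropping the first phase of (5.22)
  costs `≤ (∫|ψ|) · 2π|a₁|/(q₀q₁q₂|a₂|n₀n₁) · ∑_{|h|≤H}|h|`;
* `Drappeau2017.norm_R1piece_phase_sub_R1prime_le` — hence `|ℛ₁^{wt}(q₀,n₀) − ℛ₁'(q₀,n₀)|` is at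
  most the corresponding explicit four-fold sum (the paper's "`≪ x^ε|a₁|NQ²M^{−1}`" before sizes are
  inserted).

## References

* S. Drappeau, Proc. London Math. Soc. (3) 114 (2017) 684–732, arXiv:1504.05549, §5.5.
  [cite: Drappeau2017, §5.5]
-/

noncomputable section

open Finset Real Complex MeasureTheory
open scoped FourierTransform

namespace Literature.NumberTheory.Sieve

namespace Drappeau2017

/-! ### Bookkeeping -/

/-- Two four-fold sums `∑ c ∑ w d (e F)` and `∑ c ∑ w d (e G)` differ by at most
`∑ |c| ∑ |w| |d| |e| · bnd` when `|F − G| ≤ bnd` termwise. [folklore] -/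
theorem norm_sum4_sub_le (A B : Finset ℕ) (c w' : ℕ → ℕ → ℂ) (w : ℕ → ℕ → ℕ → ℕ → ℂ)
    (e F G : ℕ → ℕ → ℕ → ℕ → ℂ) {bnd : ℕ → ℕ → ℕ → ℕ → ℝ}
    (hFG : ∀ q₁ ∈ A, ∀ q₂ ∈ A, ∀ n₁ ∈ B, ∀ n₂ ∈ B,
      ‖F q₁ q₂ n₁ n₂ - G q₁ q₂ n₁ n₂‖ ≤ bnd q₁ q₂ n₁ n₂) :
    ‖(∑ q₁ ∈ A, ∑ q₂ ∈ A, c q₁ q₂ * ∑ n₁ ∈ B, ∑ n₂ ∈ B,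
        w q₁ q₂ n₁ n₂ * w' n₁ n₂ * (e q₁ q₂ n₁ n₂ * F q₁ q₂ n₁ n₂)) -
      ∑ q₁ ∈ A, ∑ q₂ ∈ A, c q₁ q₂ * ∑ n₁ ∈ B, ∑ n₂ ∈ B,
        w q₁ q₂ n₁ n₂ * w' n₁ n₂ * (e q₁ q₂ n₁ n₂ * G q₁ q₂ n₁ n₂)‖ ≤
      ∑ q₁ ∈ A, ∑ q₂ ∈ A, ‖c q₁ q₂‖ * ∑ n₁ ∈ B, ∑ n₂ ∈ B,
        ‖w q₁ q₂ n₁ n₂‖ * ‖w' n₁ n₂‖ * (‖e q₁ q₂ n₁ n₂‖ * bnd q₁ q₂ n₁ n₂) := by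
  have e1 : (∑ q₁ ∈ A, ∑ q₂ ∈ A, c q₁ q₂ * ∑ n₁ ∈ B, ∑ n₂ ∈ B,
        w q₁ q₂ n₁ n₂ * w' n₁ n₂ * (e q₁ q₂ n₁ n₂ * F q₁ q₂ n₁ n₂)) -
      ∑ q₁ ∈ A, ∑ q₂ ∈ A, c q₁ q₂ * ∑ n₁ ∈ B, ∑ n₂ ∈ B,
        w q₁ q₂ n₁ n₂ * w' n₁ n₂ * (e q₁ q₂ n₁ n₂ * G q₁ q₂ n₁ n₂) =
      ∑ q₁ ∈ A, ∑ q₂ ∈ A, c q₁ q₂ * ∑ n₁ ∈ B, ∑ n₂ ∈ B,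
        w q₁ q₂ n₁ n₂ * w' n₁ n₂ * (e q₁ q₂ n₁ n₂ * (F q₁ q₂ n₁ n₂ - G q₁ q₂ n₁ n₂)) := by
    simp only [← Finset.sum_sub_distrib, ← mul_sub]
  rw [e1]
  refine (norm_sum_le _ _).trans (Finset.sum_le_sum fun q₁ hq₁ => ?_)
  refine (norm_sum_le _ _).trans (Finset.sum_le_sum fun q₂ hq₂ => ?_)
  rw [norm_mul]
  refine mul_le_mul_of_nonneg_left ?_ (norm_nonneg _)
  refine (norm_sum_le _ _).trans (Finset.sum_le_sum fun n₁ hn₁ => ?_)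
  refine (norm_sum_le _ _).trans (Finset.sum_le_sum fun n₂ hn₂ => ?_)
  rw [norm_mul, norm_mul, norm_mul]
  exact mul_le_mul_of_nonneg_left (mul_le_mul_of_nonneg_left (hFG q₁ hq₁ q₂ hq₂ n₁ hn₁ n₂ hn₂)
    (norm_nonneg _)) (by positivity)

/-! ### The inner difference -/

/-- **Dropping the first phase of (5.22) inside the `h`-sum**: with `|ψ̂| ≤ ∫|ψ|` and
`|e(x) − 1| ≤ 2π|x|`,
`|∑_{|h|≤H} 1_{W∤h} ψ̂(Mh/W) (e(ha/D) Φ₂(h) Φ₃(h) − Φ₂(h) Φ₃(h))| ≤ (∫|ψ|) · 2π|a/D| · ∑_{|h|≤H} |h|`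
for any phases `|Φ_j(h)| ≤ 1`. [cite: Drappeau2017, §5.5] -/
theorem norm_hsum_phase_sub_le (ψ : ℝ → ℂ) (M : ℝ) (W H : ℕ) (a D : ℝ) {Φ₂ Φ₃ : ℤ → ℂ}
    (hΦ₂ : ∀ h, ‖Φ₂ h‖ ≤ 1) (hΦ₃ : ∀ h, ‖Φ₃ h‖ ≤ 1) :
    ‖(∑ h ∈ Finset.Icc (-(H : ℤ)) H, (if ((W : ℕ) : ℤ) ∣ h then 0 else
        𝓕 ψ (M * h / W) * ((𝐞 ((h : ℝ) * a / D) : ℂ) * Φ₂ h * Φ₃ h))) -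
      ∑ h ∈ Finset.Icc (-(H : ℤ)) H, (if ((W : ℕ) : ℤ) ∣ h then 0 else
        𝓕 ψ (M * h / W) * (Φ₂ h * Φ₃ h))‖ ≤
      (∫ t, ‖ψ t‖) * (2 * Real.pi * |a / D|) * ∑ h ∈ Finset.Icc (-(H : ℤ)) H, |(h : ℝ)| := by
  rw [← Finset.sum_sub_distrib, Finset.mul_sum]
  refine (norm_sum_le _ _).trans (Finset.sum_le_sum fun h _ => ?_)
  have hI0 : 0 ≤ ∫ t, ‖ψ t‖ := integral_nonneg fun _ => norm_nonneg _
  by_cases hd : ((W : ℕ) : ℤ) ∣ h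
  · rw [if_pos hd, if_pos hd, sub_zero, norm_zero]; positivity
  · rw [if_neg hd, if_neg hd]
    have e : 𝓕 ψ (M * h / W) * ((𝐞 ((h : ℝ) * a / D) : ℂ) * Φ₂ h * Φ₃ h) -
        𝓕 ψ (M * h / W) * (Φ₂ h * Φ₃ h) =
        𝓕 ψ (M * h / W) * (Φ₂ h * Φ₃ h) * ((𝐞 ((h : ℝ) * a / D) : ℂ) - 1) := by ring
    have hΦ : ‖Φ₂ h * Φ₃ h‖ ≤ 1 := by
      rw [norm_mul]; exact mul_le_one₀ (hΦ₂ h) (norm_nonneg _) (hΦ₃ h)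
    rw [e, norm_mul, norm_mul]
    calc ‖𝓕 ψ (M * h / W)‖ * ‖Φ₂ h * Φ₃ h‖ * ‖(𝐞 ((h : ℝ) * a / D) : ℂ) - 1‖
        ≤ (∫ t, ‖ψ t‖) * 1 * (2 * Real.pi * |(h : ℝ) * a / D|) :=
          mul_le_mul (mul_le_mul (FriedlanderIwaniecPrimes.norm_fourier_le_integral_norm _ _) hΦ
            (norm_nonneg _) hI0) (CircleMethodKernel.norm_fourierChar_sub_one_le _) (norm_nonneg _)
            (by positivity)
      _ = (∫ t, ‖ψ t‖) * (2 * Real.pi * |a / D|) * |(h : ℝ)| := by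
          rw [mul_div_assoc, abs_mul]; ring

/-! ### The piece `ℛ₁(q₀,n₀)` against `ℛ₁'(q₀,n₀)` -/

/-- **Drappeau 2017, §5.5: `ℛ₁(q₀,n₀) = ℛ₁'(q₀,n₀) + (Taylor error)`.**  Dropping the phase
`e(ha₁/(q₀q₁q₂a₂n₀n₁))` from the piece with explicit phase (`R1piece_reindexed_eq_phase`) costs at
most `∑_{q₁,q₂} |γγ| ∑_{n₁,n₂} 1·|ββ̄| (|M|/W) (∫|ψ|) 2π|a₁/(q₀q₁q₂a₂n₀n₁)| ∑_{|h|≤H}|h|`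
("the error term contributes a quantity `≪ x^ε|a₁|NQ²M^{−1}`"). [cite: Drappeau2017, §5.5] -/
theorem norm_R1piece_phase_sub_R1prime_le (a₁ a₂ : ℤ) (A B : Finset ℕ) (q₀ n₀ : ℕ) (γ : ℕ → ℝ)
    (β : ℕ → ℂ) (M : ℝ) (H : ℕ) :
    ‖(∑ q₁ ∈ A, ∑ q₂ ∈ A, (γ (q₀ * q₁) : ℂ) * (γ (q₀ * q₂) : ℂ) *
        ∑ n₁ ∈ B, ∑ n₂ ∈ B,
          (if (Nat.Coprime q₁ q₂ ∧ Nat.Coprime n₁ n₂) then (1 : ℂ) else 0) *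
            (β (n₀ * n₁) * starRingEnd ℂ (β (n₀ * n₂))) *
          ((M : ℂ) / (Nat.lcm (q₀ * q₁) (q₀ * q₂) : ℂ) *
            (if ((n₀ * n₁).Coprime (q₀ * q₁) ∧ (n₀ * n₂).Coprime (q₀ * q₂) ∧ n₁ ≡ n₂ [MOD q₀]) then
              ∑ h ∈ Finset.Icc (-(H : ℤ)) H,
                (if ((Nat.lcm (q₀ * q₁) (q₀ * q₂) : ℕ) : ℤ) ∣ h then 0 else
                  𝓕 (BFI.bumpC 1 (1 / 2)) (M * h / (Nat.lcm (q₀ * q₁) (q₀ * q₂) : ℕ)) *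
                    ((𝐞 ((h : ℝ) * a₁ / ((q₀ : ℝ) * q₁ * q₂ * a₂ * n₀ * n₁)) : ℂ) *
                      (𝐞 ((h : ℝ) * a₁ * ((((n₁ : ℤ) - n₂) / q₀ : ℤ)) *
                        ((((((q₁ : ℤ) * a₂ * n₀ * n₂ : ℤ) : ZMod (n₁ * q₂))⁻¹).val : ℕ) : ℝ) /
                          ((n₁ : ℝ) * q₂)) : ℂ) *
                      (𝐞 (-((h : ℝ) * a₁ *
                        ((((((q₀ : ℤ) * q₁ * q₂ * n₁ : ℤ) : ZMod (a₂.natAbs * n₀))⁻¹).val : ℕ) : ℝ) /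
                          ((a₂ : ℝ) * n₀))) : ℂ)))
            else 0))) -
      ∑ q₁ ∈ A, ∑ q₂ ∈ A, (γ (q₀ * q₁) : ℂ) * (γ (q₀ * q₂) : ℂ) *
        ∑ n₁ ∈ B, ∑ n₂ ∈ B,
          (if (Nat.Coprime q₁ q₂ ∧ Nat.Coprime n₁ n₂) then (1 : ℂ) else 0) *
            (β (n₀ * n₁) * starRingEnd ℂ (β (n₀ * n₂))) *
          ((M : ℂ) / (Nat.lcm (q₀ * q₁) (q₀ * q₂) : ℂ) *
            (if ((n₀ * n₁).Coprime (q₀ * q₁) ∧ (n₀ * n₂).Coprime (q₀ * q₂) ∧ n₁ ≡ n₂ [MOD q₀]) then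
              ∑ h ∈ Finset.Icc (-(H : ℤ)) H,
                (if ((Nat.lcm (q₀ * q₁) (q₀ * q₂) : ℕ) : ℤ) ∣ h then 0 else
                  𝓕 (BFI.bumpC 1 (1 / 2)) (M * h / (Nat.lcm (q₀ * q₁) (q₀ * q₂) : ℕ)) *
                    ((𝐞 ((h : ℝ) * a₁ * ((((n₁ : ℤ) - n₂) / q₀ : ℤ)) *
                        ((((((q₁ : ℤ) * a₂ * n₀ * n₂ : ℤ) : ZMod (n₁ * q₂))⁻¹).val : ℕ) : ℝ) /
                          ((n₁ : ℝ) * q₂)) : ℂ) *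
                      (𝐞 (-((h : ℝ) * a₁ *
                        ((((((q₀ : ℤ) * q₁ * q₂ * n₁ : ℤ) : ZMod (a₂.natAbs * n₀))⁻¹).val : ℕ) : ℝ) /
                          ((a₂ : ℝ) * n₀))) : ℂ)))
            else 0))‖ ≤
      ∑ q₁ ∈ A, ∑ q₂ ∈ A, ‖(γ (q₀ * q₁) : ℂ) * (γ (q₀ * q₂) : ℂ)‖ *
        ∑ n₁ ∈ B, ∑ n₂ ∈ B,
          ‖(if (Nat.Coprime q₁ q₂ ∧ Nat.Coprime n₁ n₂) then (1 : ℂ) else 0)‖ *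
            ‖β (n₀ * n₁) * starRingEnd ℂ (β (n₀ * n₂))‖ *
          (‖(M : ℂ) / (Nat.lcm (q₀ * q₁) (q₀ * q₂) : ℂ)‖ *
            ((∫ t, ‖BFI.bumpC 1 (1 / 2) t‖) *
              (2 * Real.pi * |(a₁ : ℝ) / ((q₀ : ℝ) * q₁ * q₂ * a₂ * n₀ * n₁)|) *
              ∑ h ∈ Finset.Icc (-(H : ℤ)) H, |(h : ℝ)|)) := by
  refine norm_sum4_sub_le A B (fun q₁ q₂ => (γ (q₀ * q₁) : ℂ) * (γ (q₀ * q₂) : ℂ))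
    (fun n₁ n₂ => β (n₀ * n₁) * starRingEnd ℂ (β (n₀ * n₂)))
    (fun q₁ q₂ n₁ n₂ => if (Nat.Coprime q₁ q₂ ∧ Nat.Coprime n₁ n₂) then (1 : ℂ) else 0)
    (fun q₁ q₂ _ _ => (M : ℂ) / (Nat.lcm (q₀ * q₁) (q₀ * q₂) : ℂ)) _ _ fun q₁ _ q₂ _ n₁ _ n₂ _ => ?_
  have h0 : 0 ≤ (∫ t, ‖BFI.bumpC 1 (1 / 2) t‖) *
      (2 * Real.pi * |(a₁ : ℝ) / ((q₀ : ℝ) * q₁ * q₂ * a₂ * n₀ * n₁)|) *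
      ∑ h ∈ Finset.Icc (-(H : ℤ)) H, |(h : ℝ)| := by
    have : 0 ≤ ∫ t, ‖BFI.bumpC 1 (1 / 2) t‖ := integral_nonneg fun _ => norm_nonneg _
    have : 0 ≤ ∑ h ∈ Finset.Icc (-(H : ℤ)) H, |(h : ℝ)| := Finset.sum_nonneg fun _ _ => abs_nonneg _
    positivity
  by_cases hc : ((n₀ * n₁).Coprime (q₀ * q₁) ∧ (n₀ * n₂).Coprime (q₀ * q₂) ∧ n₁ ≡ n₂ [MOD q₀])
  · rw [if_pos hc, if_pos hc]
    exact norm_hsum_phase_sub_le _ _ _ _ _ _ (fun h => (Circle.norm_coe _).le)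
      (fun h => (Circle.norm_coe _).le)
  · rw [if_neg hc, if_neg hc, sub_zero, norm_zero]
    exact h0

end Drappeau2017

end Literature.NumberTheory.Sieve

end
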